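import Literature.IUT.HodgeArakelov.ThetaEnvDataRecordAutIntrinsic
import Literature.IUT.HodgeArakelov.EtaleThetaDataOfSettingAutActionInner

/-!
# [IUTchII] Prop 3.4 (i) at the GENUINE data, `ι` ranging over the `Aut_top(Π^tp_{X̲̲})`-SATURATED orbit of the action
# of one inversion automorphism `ι₀`: binder (P2) DISCHARGED (restate route of GAP row G-w5d169-1)

S. Mochizuki, *Inter-universal Teichmüller theory II*, kurims manuscript (Dec. 2020): Prop 3.4 (i) pp. 91–92
[cite: Mochizuki2012, Prop 3.4 (i) p.91]; Prop 3.1 (i) p. 87 ("[`ι` ranges] over the inversion automorphisms of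
Proposition 2.2, (i)"); Prop 2.2 (i) p. 66 ("The collection of data `(Π_{v•} ⊆ Π_{v▶} ⊆ Π_v, ι)`, regarded up to
`Π_v`-conjugacy, may be reconstructed via a functorial group-theoretic algorithm from the topological group `Π_v`");
Rmk 1.4.1 (ii) p. 28 ("an order two automorphism `ι_Ÿ` … uniquely determined up to `l·ℤ`-conjugacy and composition
with an element `∈ Gal(Ÿ_k/Y_k)`").  Claim key DISPUTED (D-0012); [EtTh] Cor. 2.18 (i) p. 60 = FACT-LIST F-0620, BY NAME.
abc-iut cell, layer L6, seat abc-iut-w6-d002 (gen 2); GAP row G-w5d169-1 of abc-iut-w5-d169 (holder of DAG node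
IUTchII:Prop3.4(i)), its clause "OR restate: replace the orbit index set … (then (P2) is automatic)".

WHAT IS BUILT over abc-iut-w5-d169's `ThetaEnvDataRecordAutIntrinsic.lean` (p429735) and
`EtaleThetaDataOfSettingAutAction(Inner).lean` (p430185), everything consumed BY NAME, nothing restated; no
`Prop`-valued definition, no named fact, no instance, no notation.  Write `ρ_α := autActOfCor218i … α` for the
Π-INTRINSIC action of `α ∈ Aut_top(Π^tp_{X̲̲})` on `lim_J H¹(Π^tp_{Ÿ̲̲} ∩ J, l·Δ_Θ)` (inputs F-0620 and `hq`).
* `EtaleLevels.saturatedOrbit ι₀` — the SET `I_sat(ι₀) := {ρ_α ∘ ρ_{ι₀} ∘ ρ_α⁻¹ | α ∈ Aut_top(Π^tp_{X̲̲})}`: the transports of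
  the inversion action `ρ_{ι₀}` along ALL topological automorphisms of `Π^tp_{X̲̲}` — what Prop 2.2 (i)'s "functorial"
  yields for the collection of inversion automorphisms, and nothing more.  It CONTAINS the `Π^tp_{X̲̲}`-conjugacy orbit
  `inversionOrbit ρ_{ι₀}` of p423712 (`inversionOrbit_subset_saturatedOrbit`; conjugation by `h` is `ρ_{conj h}`,
  `autActOfCor218i_conjCME`), is stable under `Π^tp_{X̲̲}`-conjugation (`conj_mem_saturatedOrbit`; J2
  `thetaEnvPermuted_thetaEnvRecordSat`) and, BY CONSTRUCTION, under conjugation by every `ρ_β`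
  (`conjAct_mem_saturatedOrbit`) — binder (P2) `hρ` of p429735 / `hconj` of p430623 is not needed for this index set;
  `saturatedOrbit_eq_inversionOrbit_of_iotaConj`: under G-w5d169-1's `hconj` VERBATIM, `I_sat(ι₀)` IS that single orbit
  (abc-iut-w5-d169's p430623 = the special case "the collection is ONE orbit"; `hconj` is used nowhere else below).
* `thetaEnvRecordSat`, `orbitEquivS`, `recordIsoOfS`, `autIsoActionOrbitS`, `thetaEnvTransportS` — the Prop 3.1 record
  indexed by `I_sat(ι₀)`, the index matching along `α`, the record isomorphism along `α`, the FUNCTORIAL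
  `Aut(Π^tp_{X̲̲})`-action (J10) and the transport input: p429735's constructions with the new index set.
* **`prop34i_multiradiallyDefined_saturated`** — [IUTchII] Prop 3.4 (i) multiradiality AT THE GENUINE FUNCTOR with
  residual exactly: F-0620 (named FACT) · `hq` · (P3) `hκ` · (P4) `hθ`/`hinf` (same shapes as p429735/p430623) · the
  record's standing inputs — abc-iut-w5-d169's residual list MINUS (P2)/G-w5d169-1.
READING: print lets `ι` range over a COLLECTION of inversion automorphisms (Prop 3.1 (i) p. 87; Rmk 1.4.1 (ii) p. 28
fixes `ι_Ÿ` only up to stated indeterminacies), functorial in `Π_v` (Prop 2.2 (i) p. 66); `I_sat(ι₀)` is the closure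
of `ρ_{ι₀}` under the transports that functoriality provides; that the collection is a SINGLE `Π_v`-conjugacy orbit
(`hconj`, G-w5d169-1) is an additional statement used by nothing below.  Nothing here asserts anything of
[IUTchII]; no side taken on [IUTchIII] Cor 3.12; typed ≠ proved.
-/

noncomputable section

open Topology

namespace Literature.IUT.HodgeArakelov

open Literature.AnabelianGeometry.EtaleTheta Literature.AnabelianGeometry.SemiGraphs
open CohomologySystemOfContH1 EtaleThetaDataOfSetting TemperedThetaMonoids
open Literature.AnabelianGeometry.SemiGraphs.Thm68Sub (conjCME conjCME_apply)
open scoped Literature.AnabelianGeometry.EtaleTheta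

/-- If a multiplicative automorphism carries a submonoid onto itself, it carries its unit group (abc-iut-w4-d019's
`unitsOfSubmonoid`) onto itself (local copy of the private helper of p423712/p429735). [folklore] -/
private theorem unitsOfSubmonoid_map_eq_of_map_eq {H : Type} [CommGroup H] (S : Submonoid H) (e : H ≃* H)
    (h : S.map (e : H →* H) = S) : (unitsOfSubmonoid S).map (e : H →* H) = unitsOfSubmonoid S := by
  have hmem : ∀ x, x ∈ S → e x ∈ S := fun x hx => by rw [← h]; exact ⟨x, hx, rfl⟩
  have hmem' : ∀ y, y ∈ S → e.symm y ∈ S := fun y hy => by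
    rw [← h] at hy; obtain ⟨x, hx, rfl⟩ := hy; rw [MonoidHom.coe_coe, e.symm_apply_apply]; exact hx
  ext y; constructor
  · rintro ⟨x, ⟨hx, hx'⟩, rfl⟩
    exact ⟨hmem x hx, by rw [MonoidHom.coe_coe, ← map_inv]; exact hmem _ hx'⟩
  · rintro ⟨hy, hy'⟩
    refine ⟨e.symm y, ⟨hmem' y hy, ?_⟩, by simp⟩
    rw [← map_inv]; exact hmem' _ hy'

namespace EtaleLevels

variable {p : ℕ} [Fact p.Prime] {D : Literature.AnabelianGeometry.EtaleTheta.ThetaSetting p}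
  {E : D.EtaleThetaData} {l : ℕ} (C : E.DoubleUnderline l) (hC : D.Compat) (hS : D.Sec2Hyps)
  (hl : l.Prime) (hp2 : p ≠ 2) (hpl : p ≠ l) (hζ : ∃ ζ : D.K, IsPrimitiveRoot ζ (4 * l))
  (mods : ∀ M : ℕ+, D.CyclotomeMod l M)
  (f : contCocycles D.toTheta D.DeltaTheta C.GtpYdduu) (hf : f ∈ C.rootCocycles hC)
  (hmods : ∀ (M M' : ℕ+) (h : (M : ℕ) ∣ (M' : ℕ)) (x : D.lDeltaTheta l),
    MuN.red p M M' h ((mods M').red x) = (mods M).red x)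
  (h15 : Literature.AnabelianGeometry.EtaleTheta.ThetaSetting.Prop15iii E hC) (L : C.CuspLabels)
  (hZ : ∀ M : ℕ+, Nonempty (ModelCyclotomes.lDeltaQuot (C.rigidData (mods M) hC hS h15 L) ≃*
    Literature.IUT.HodgeTheaters.ZHat))
  (hcharY : EtaleThetaDataOfSetting.PiYddCharacteristic C)
  (hlim : Function.Bijective (rigidLimHom C hC hS hl hp2 hpl hζ mods f hf hmods h15 L hZ))
  [(EtaleThetaDataOfSetting.PiYdd C).Normal]
  (hq : IsQuotientMap D.toTheta) {N : ℕ+} (μ : D.CyclotomeMod l N)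
  (R : RigidData.{0} N l) (hR : R = C.rigidData μ hC hS h15 L) (h218i : R.Cor218_i)

/-! ### 1. The saturated orbit `I_sat(ι₀)` and its stabilities (no hypothesis) -/

section Orbit

variable (ι₀ : (Pi C) ≃ₜ* (Pi C))

/-- **The `Aut_top(Π^tp_{X̲̲})`-saturated orbit `I_sat(ι₀) = {ρ_α ∘ ρ_{ι₀} ∘ ρ_α⁻¹}`** of the Π-intrinsic action `ρ_{ι₀}` of
an inversion automorphism `ι₀` of `Π^tp_{X̲̲}`: its transports along ALL topological automorphisms `α` of `Π^tp_{X̲̲}`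
("functorial … from the topological group `Π_v`", Prop 2.2 (i); "`ι` ranges over the inversion automorphisms",
Prop 3.1 (i)) — a SET of additive automorphisms of `lim_J H¹(Π^tp_{Ÿ̲̲} ∩ J, l·Δ_Θ)`. [cite: Mochizuki2012, Prop 2.2 (i) p.66] -/
def saturatedOrbit :
    Set (h1Lim (phi C) (D.lDeltaTheta l) (PiYdd C) ⊥ ≃+ h1Lim (phi C) (D.lDeltaTheta l) (PiYdd C) ⊥) :=
  {e | ∃ α : (Pi C) ≃ₜ* (Pi C), ∀ x,
    e x = autActOfCor218i C hq μ hC hS h15 L R hR h218i α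
      (autActOfCor218i C hq μ hC hS h15 L R hR h218i ι₀
        ((autActOfCor218i C hq μ hC hS h15 L R hR h218i α).symm x))}

omit [(EtaleThetaDataOfSetting.PiYdd C).Normal] in
/-- The inverse of the action of a composite is the composite of the inverses (reversed). [cite: Mochizuki2012, Cor 1.12 (i) p.57] -/
theorem autActOfCor218i_trans_symm_apply (α₁ α₂ : (Pi C) ≃ₜ* (Pi C))
    (x : h1Lim (phi C) (D.lDeltaTheta l) (PiYdd C) ⊥) :
    (autActOfCor218i C hq μ hC hS h15 L R hR h218i (α₁.trans α₂)).symm x =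
      (autActOfCor218i C hq μ hC hS h15 L R hR h218i α₁).symm
        ((autActOfCor218i C hq μ hC hS h15 L R hR h218i α₂).symm x) := by
  apply (autActOfCor218i C hq μ hC hS h15 L R hR h218i (α₁.trans α₂)).injective
  rw [AddEquiv.apply_symm_apply, autActOfCor218i_trans, AddEquiv.apply_symm_apply, AddEquiv.apply_symm_apply]

omit [(EtaleThetaDataOfSetting.PiYdd C).Normal] in
/-- The inverse of the action of the identity is the identity. [cite: Mochizuki2012, Cor 1.12 (i) p.57] -/
theorem autActOfCor218i_refl_symm_apply (x : h1Lim (phi C) (D.lDeltaTheta l) (PiYdd C) ⊥) :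
    (autActOfCor218i C hq μ hC hS h15 L R hR h218i (ContinuousMulEquiv.refl (Pi C))).symm x = x := by
  apply (autActOfCor218i C hq μ hC hS h15 L R hR h218i (ContinuousMulEquiv.refl (Pi C))).injective
  rw [AddEquiv.apply_symm_apply, autActOfCor218i_refl]

/-- Conjugation by `h⁻¹` on the limit is the inverse of the action of the inner automorphism `conj h`.
[cite: Mochizuki2012, Cor 1.12 (i) p.56] -/
theorem h1LimConj_inv_eq_autActOfCor218i_conjCME_symm (h : Pi C) (x : h1Lim (phi C) (D.lDeltaTheta l) (PiYdd C) ⊥) :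
    h1LimConj (phi C) (D.lDeltaTheta l) (PiYdd C) h⁻¹ x =
      (autActOfCor218i C hq μ hC hS h15 L R hR h218i (conjCME h)).symm x := by
  apply (autActOfCor218i C hq μ hC hS h15 L R hR h218i (conjCME h)).injective
  rw [AddEquiv.apply_symm_apply, autActOfCor218i_conjCME, ← h1LimConj_mul_apply, mul_inv_cancel,
    h1LimConj_one_apply]

omit [(EtaleThetaDataOfSetting.PiYdd C).Normal] in
/-- `ρ_{ι₀}` itself lies in `I_sat(ι₀)` (`α := id`). [cite: Mochizuki2012, Prop 3.1 (i) p.87] -/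
theorem autActOfCor218i_mem_saturatedOrbit :
    autActOfCor218i C hq μ hC hS h15 L R hR h218i ι₀ ∈ saturatedOrbit C hC hS h15 L hq μ R hR h218i ι₀ :=
  ⟨ContinuousMulEquiv.refl (Pi C), fun x => by
    rw [autActOfCor218i_refl, autActOfCor218i_refl_symm_apply]⟩

omit [(EtaleThetaDataOfSetting.PiYdd C).Normal] in
/-- **`I_sat(ι₀)` is stable under conjugation by the action of EVERY `β ∈ Aut_top(Π^tp_{X̲̲})`**, by construction
(`ρ_β (ρ_α ρ_{ι₀} ρ_α⁻¹) ρ_β⁻¹ = ρ_{αβ} ρ_{ι₀} ρ_{αβ}⁻¹`): binder (P2) of p429735, now a theorem. [cite: Mochizuki2012, Prop 2.2 (i) p.66] -/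
theorem conjAct_mem_saturatedOrbit (β : (Pi C) ≃ₜ* (Pi C))
    {e : h1Lim (phi C) (D.lDeltaTheta l) (PiYdd C) ⊥ ≃+ h1Lim (phi C) (D.lDeltaTheta l) (PiYdd C) ⊥}
    (he : e ∈ saturatedOrbit C hC hS h15 L hq μ R hR h218i ι₀) :
    ((autActOfCor218i C hq μ hC hS h15 L R hR h218i β).symm.trans
      (e.trans (autActOfCor218i C hq μ hC hS h15 L R hR h218i β))) ∈
        saturatedOrbit C hC hS h15 L hq μ R hR h218i ι₀ := by
  obtain ⟨α, hα⟩ := he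
  refine ⟨α.trans β, fun x => ?_⟩
  rw [AddEquiv.trans_apply, AddEquiv.trans_apply, hα, autActOfCor218i_trans, autActOfCor218i_trans_symm_apply]

omit [(EtaleThetaDataOfSetting.PiYdd C).Normal] in
/-- … and under conjugation the other way (by the action of `β⁻¹`). [cite: Mochizuki2012, Prop 2.2 (i) p.66] -/
theorem conjActSymm_mem_saturatedOrbit (β : (Pi C) ≃ₜ* (Pi C))
    {e : h1Lim (phi C) (D.lDeltaTheta l) (PiYdd C) ⊥ ≃+ h1Lim (phi C) (D.lDeltaTheta l) (PiYdd C) ⊥}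
    (he : e ∈ saturatedOrbit C hC hS h15 L hq μ R hR h218i ι₀) :
    ((autActOfCor218i C hq μ hC hS h15 L R hR h218i β).trans
      (e.trans (autActOfCor218i C hq μ hC hS h15 L R hR h218i β).symm)) ∈
        saturatedOrbit C hC hS h15 L hq μ R hR h218i ι₀ := by
  obtain ⟨α', hα'⟩ := conjAct_mem_saturatedOrbit C hC hS h15 L hq μ R hR h218i ι₀ β.symm he
  refine ⟨α', fun x => ?_⟩
  rw [← hα' x, AddEquiv.trans_apply, AddEquiv.trans_apply, AddEquiv.trans_apply, AddEquiv.trans_apply,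
    autActOfCor218i_symm, autActOfCor218i_symm_symm]

/-- **`I_sat(ι₀)` is stable under `Π^tp_{X̲̲}`-conjugation**: conjugation by `g` is the action of the inner automorphism
`conj g` (abc-iut-w5-d169's `autActOfCor218i_conjCME`). [cite: Mochizuki2012, Prop 2.2 (i) p.66] -/
theorem conj_mem_saturatedOrbit (g : Pi C)
    {e : h1Lim (phi C) (D.lDeltaTheta l) (PiYdd C) ⊥ ≃+ h1Lim (phi C) (D.lDeltaTheta l) (PiYdd C) ⊥}
    (he : e ∈ saturatedOrbit C hC hS h15 L hq μ R hR h218i ι₀) :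
    ((h1LimConjEquiv (phi C) (D.lDeltaTheta l) (PiYdd C) g⁻¹).trans
      (e.trans (h1LimConjEquiv (phi C) (D.lDeltaTheta l) (PiYdd C) g))) ∈
        saturatedOrbit C hC hS h15 L hq μ R hR h218i ι₀ := by
  obtain ⟨α', hα'⟩ := conjAct_mem_saturatedOrbit C hC hS h15 L hq μ R hR h218i ι₀ (conjCME g) he
  refine ⟨α', fun x => ?_⟩
  rw [← hα' x, AddEquiv.trans_apply, AddEquiv.trans_apply, AddEquiv.trans_apply, AddEquiv.trans_apply,
    h1LimConjEquiv_apply, h1LimConjEquiv_apply, autActOfCor218i_conjCME,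
    h1LimConj_inv_eq_autActOfCor218i_conjCME_symm]

/-- **The `Π^tp_{X̲̲}`-conjugacy orbit of `ρ_{ι₀}` lies in `I_sat(ι₀)`**, with NO hypothesis. [cite: Mochizuki2012, Prop 3.1 (i) p.87] -/
theorem inversionOrbit_subset_saturatedOrbit :
    inversionOrbit C (autActOfCor218i C hq μ hC hS h15 L R hR h218i ι₀) ⊆
      saturatedOrbit C hC hS h15 L hq μ R hR h218i ι₀ := by
  rintro e ⟨h, hh⟩
  refine ⟨conjCME h, fun x => ?_⟩
  rw [hh, autActOfCor218i_conjCME, h1LimConj_inv_eq_autActOfCor218i_conjCME_symm]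

/-- **Bridge to GAP row G-w5d169-1**: under its `hconj` VERBATIM ("`α ∘ ι₀ ∘ α⁻¹` is `Π_v`-conjugate to `ι₀` for every
topological automorphism `α`"), `I_sat(ι₀)` IS the single `Π^tp_{X̲̲}`-conjugacy orbit `inversionOrbit ρ_{ι₀}` of
abc-iut-w5-d169's p430623 (via `orbitHyp_of_iotaConj`). [cite: Mochizuki2012, Prop 2.2 (i) p.66] -/
theorem saturatedOrbit_eq_inversionOrbit_of_iotaConj
    (hconj : ∀ α : (Pi C) ≃ₜ* (Pi C), ∃ c : Pi C, ∀ g, α (ι₀ (α.symm g)) = c * ι₀ (c⁻¹ * g * c) * c⁻¹) :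
    saturatedOrbit C hC hS h15 L hq μ R hR h218i ι₀ =
      inversionOrbit C (autActOfCor218i C hq μ hC hS h15 L R hR h218i ι₀) := by
  refine Set.Subset.antisymm ?_ (inversionOrbit_subset_saturatedOrbit C hC hS h15 L hq μ R hR h218i ι₀)
  rintro e ⟨α, hα⟩
  obtain ⟨c, hc⟩ := orbitHyp_of_iotaConj C hq μ hC hS h15 L R hR h218i ι₀ hconj α
  refine ⟨c, fun x => ?_⟩
  rw [hα, hc, AddEquiv.apply_symm_apply]

omit [(EtaleThetaDataOfSetting.PiYdd C).Normal] in
/-- **The index matching induced by `β`** on `I_sat(ι₀)`: conjugation by the intrinsic action `ρ_β`, a bijection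
(inverse: conjugation by `ρ_{β⁻¹}`); no hypothesis. [cite: Mochizuki2012, Prop 3.4 (i) p.91] -/
def orbitEquivS (β : (Pi C) ≃ₜ* (Pi C)) :
    saturatedOrbit C hC hS h15 L hq μ R hR h218i ι₀ ≃ saturatedOrbit C hC hS h15 L hq μ R hR h218i ι₀ where
  toFun e := ⟨(autActOfCor218i C hq μ hC hS h15 L R hR h218i β).symm.trans
      (e.1.trans (autActOfCor218i C hq μ hC hS h15 L R hR h218i β)),
    conjAct_mem_saturatedOrbit C hC hS h15 L hq μ R hR h218i ι₀ β e.2⟩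
  invFun e := ⟨(autActOfCor218i C hq μ hC hS h15 L R hR h218i β).trans
      (e.1.trans (autActOfCor218i C hq μ hC hS h15 L R hR h218i β).symm),
    conjActSymm_mem_saturatedOrbit C hC hS h15 L hq μ R hR h218i ι₀ β e.2⟩
  left_inv e := Subtype.ext (AddEquiv.ext fun x => by
    change (autActOfCor218i C hq μ hC hS h15 L R hR h218i β).symm
        (autActOfCor218i C hq μ hC hS h15 L R hR h218i β
          (e.1 ((autActOfCor218i C hq μ hC hS h15 L R hR h218i β).symm
            (autActOfCor218i C hq μ hC hS h15 L R hR h218i β x)))) = e.1 x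
    rw [AddEquiv.symm_apply_apply, AddEquiv.symm_apply_apply])
  right_inv e := Subtype.ext (AddEquiv.ext fun x => by
    change autActOfCor218i C hq μ hC hS h15 L R hR h218i β
        ((autActOfCor218i C hq μ hC hS h15 L R hR h218i β).symm
          (e.1 (autActOfCor218i C hq μ hC hS h15 L R hR h218i β
            ((autActOfCor218i C hq μ hC hS h15 L R hR h218i β).symm x)))) = e.1 x
    rw [AddEquiv.apply_symm_apply, AddEquiv.apply_symm_apply])

omit [(EtaleThetaDataOfSetting.PiYdd C).Normal] in
/-- The matched index intertwines the action: `e'(ρ_β x) = ρ_β (e x)`. [cite: Mochizuki2012, Prop 3.4 (i) p.91] -/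
theorem orbitEquivS_apply_apply (β : (Pi C) ≃ₜ* (Pi C)) (e : saturatedOrbit C hC hS h15 L hq μ R hR h218i ι₀)
    (x : h1Lim (phi C) (D.lDeltaTheta l) (PiYdd C) ⊥) :
    (orbitEquivS C hC hS h15 L hq μ R hR h218i ι₀ β e).1 (autActOfCor218i C hq μ hC hS h15 L R hR h218i β x) =
      autActOfCor218i C hq μ hC hS h15 L R hR h218i β (e.1 x) := by
  change autActOfCor218i C hq μ hC hS h15 L R hR h218i β
      (e.1 ((autActOfCor218i C hq μ hC hS h15 L R hR h218i β).symm
        (autActOfCor218i C hq μ hC hS h15 L R hR h218i β x))) = _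
  rw [AddEquiv.symm_apply_apply]

end Orbit

/-! ### 2. The Prop 3.1 record indexed by `I_sat(ι₀)` and J2 for it -/

section Record

variable {M : Type} [CommMonoid M]
  (κ : M →* Multiplicative (thetaEnvData C hC hS hl hp2 hpl hζ mods f hf hmods h15 L hZ hcharY hlim).cohEnv.lim)
  (ι₀ : (Pi C) ≃ₜ* (Pi C))

/-- **The [IUTchII] Prop 3.1 input record of the natural system of `X̲̲_K` with `ι` ranging over `I_sat(ι₀)`**
(abc-iut-w4-d019's `toRecord` over abc-iut-w4-d030's genuine `θ_env` data; the record of p423712 with the saturated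
index set). [cite: Mochizuki2012, Prop 3.1 (i) p.87] -/
def thetaEnvRecordSat :
    TemperedThetaMonoids.ThetaEnvData.{0, 0} (modelSystem C hC hS hl hp2 hpl hζ mods f hf hmods h15 L hZ).PiX :=
  (thetaEnvData C hC hS hl hp2 hpl hζ mods f hf hmods h15 L hZ hcharY hlim).toRecord
    (h1LimConjMulAut (phi C) (D.lDeltaTheta l) (PiYdd C)) κ
    (fun e : saturatedOrbit C hC hS h15 L hq μ R hR h218i ι₀ =>
      (e : h1Lim (phi C) (D.lDeltaTheta l) (PiYdd C) ⊥ ≃+ h1Lim (phi C) (D.lDeltaTheta l) (PiYdd C) ⊥))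

/-- **J2 for the `I_sat(ι₀)`-indexed record**: the conjugation action PERMUTES `{θ^ι_env}_ι`, `{∞θ^ι_env}_ι`,
UNCONDITIONALLY (`thetaEnvPermuted_record` with `conj_mem_saturatedOrbit`). [cite: Mochizuki2012, Prop 3.1 (i) p.87] -/
theorem thetaEnvPermuted_thetaEnvRecordSat :
    (thetaEnvRecordSat C hC hS hl hp2 hpl hζ mods f hf hmods h15 L hZ hcharY hlim hq μ R hR h218i κ ι₀).ThetaEnvPermuted :=
  thetaEnvPermuted_record C hC hS hl hp2 hpl hζ mods f hf hmods h15 L hZ hcharY hlim κ _ fun g e =>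
    ⟨⟨_, conj_mem_saturatedOrbit C hC hS h15 L hq μ R hR h218i ι₀ g e.2⟩, fun x => by
      change h1LimConj (phi C) (D.lDeltaTheta l) (PiYdd C) g
          (e.1 (h1LimConj (phi C) (D.lDeltaTheta l) (PiYdd C) g⁻¹
            (h1LimConj (phi C) (D.lDeltaTheta l) (PiYdd C) g x))) =
        h1LimConj (phi C) (D.lDeltaTheta l) (PiYdd C) g (e.1 x)
      rw [← h1LimConj_mul_apply, inv_mul_cancel, h1LimConj_one_apply]⟩

end Record

/-! ### 3. The `AutIsoAction` on the `I_sat(ι₀)`-indexed record (J10) and Prop 3.4 (i) multiradiality -/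

section Action

variable {M : Type} [CommMonoid M]
  (κ : M →* Multiplicative (thetaEnvData C hC hS hl hp2 hpl hζ mods f hf hmods h15 L hZ hcharY hlim).cohEnv.lim)
  (ι₀ : (Pi C) ≃ₜ* (Pi C))
  (hκ : ∀ α : (Pi C) ≃ₜ* (Pi C),
    (MonoidHom.mrange κ).map (AddEquiv.toMultiplicative (autActOfCor218i C hq μ hC hS h15 L R hR h218i α) :
      Multiplicative (h1Lim (phi C) (D.lDeltaTheta l) (PiYdd C) ⊥) →*
        Multiplicative (h1Lim (phi C) (D.lDeltaTheta l) (PiYdd C) ⊥)) = MonoidHom.mrange κ)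
  (hθ : ∀ α : (Pi C) ≃ₜ* (Pi C), autActOfCor218i C hq μ hC hS h15 L R hR h218i α ''
    ((thetaEnvData C hC hS hl hp2 hpl hζ mods f hf hmods h15 L hZ hcharY hlim).D.coh.toLim ⊤ ''
      (thetaEnvData C hC hS hl hp2 hpl hζ mods f hf hmods h15 L hZ hcharY hlim).D.theta) =
    (thetaEnvData C hC hS hl hp2 hpl hζ mods f hf hmods h15 L hZ hcharY hlim).D.coh.toLim ⊤ ''
      (thetaEnvData C hC hS hl hp2 hpl hζ mods f hf hmods h15 L hZ hcharY hlim).D.theta)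
  (hinf : ∀ α : (Pi C) ≃ₜ* (Pi C), autActOfCor218i C hq μ hC hS h15 L R hR h218i α ''
    (thetaEnvData C hC hS hl hp2 hpl hζ mods f hf hmods h15 L hZ hcharY hlim).D.thetaInfty =
    (thetaEnvData C hC hS hl hp2 hpl hζ mods f hf hmods h15 L hZ hcharY hlim).D.thetaInfty)

include hθ hinf in
/-- **The isomorphism of the `I_sat(ι₀)`-indexed record ALONG `α`**: module component `ρ_α`; index component =
conjugation of `I_sat(ι₀)` by `ρ_α` (no hypothesis); `map_conj` = `autActOfCor218i_conj`; units/constants by (P3);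
`θ^ι_env ↦ θ^{ι'}_env`, `∞θ^ι_env ↦ ∞θ^{ι'}_env` by (P4) — p429735's `recordIsoOfI` with the new index set.
[cite: Mochizuki2012, Prop 3.4 (i) p.91] -/
def recordIsoOfS (α : (Pi C) ≃ₜ* (Pi C)) :
    TemperedThetaMonoids.ThetaEnvData.Iso
      (thetaEnvRecordSat C hC hS hl hp2 hpl hζ mods f hf hmods h15 L hZ hcharY hlim hq μ R hR h218i κ ι₀)
      (thetaEnvRecordSat C hC hS hl hp2 hpl hζ mods f hf hmods h15 L hZ hcharY hlim hq μ R hR h218i κ ι₀) where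
  phi := α.toMulEquiv
  e := AddEquiv.toMultiplicative (autActOfCor218i C hq μ hC hS h15 L R hR h218i α)
  iota := orbitEquivS C hC hS h15 L hq μ R hR h218i ι₀ α
  map_conj g x := by
    change Multiplicative.ofAdd (autActOfCor218i C hq μ hC hS h15 L R hR h218i α
        (h1LimConj (phi C) (D.lDeltaTheta l) (PiYdd C) g (Multiplicative.toAdd x))) =
      Multiplicative.ofAdd (h1LimConj (phi C) (D.lDeltaTheta l) (PiYdd C) (α g)
        (autActOfCor218i C hq μ hC hS h15 L R hR h218i α (Multiplicative.toAdd x)))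
    rw [autActOfCor218i_conj]
  map_units := unitsOfSubmonoid_map_eq_of_map_eq _ _ (hκ α)
  map_constants := hκ α
  image_thetaEnv ι := by
    change AddEquiv.toMultiplicative (autActOfCor218i C hq μ hC hS h15 L R hR h218i α) ''
        (thetaEnvData C hC hS hl hp2 hpl hζ mods f hf hmods h15 L hZ hcharY hlim).envSet
          ((thetaEnvData C hC hS hl hp2 hpl hζ mods f hf hmods h15 L hZ hcharY hlim).thetaIotaLim ι.1) =
      (thetaEnvData C hC hS hl hp2 hpl hζ mods f hf hmods h15 L hZ hcharY hlim).envSet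
        ((thetaEnvData C hC hS hl hp2 hpl hζ mods f hf hmods h15 L hZ hcharY hlim).thetaIotaLim
          (orbitEquivS C hC hS h15 L hq μ R hR h218i ι₀ α ι).1)
    refine (ThetaEnvData.image_envSet_of_compat (thetaEnvData C hC hS hl hp2 hpl hζ mods f hf hmods h15 L hZ hcharY hlim)
      (AddEquiv.toMultiplicative (autActOfCor218i C hq μ hC hS h15 L R hR h218i α))
      (autActOfCor218i C hq μ hC hS h15 L R hR h218i α) (fun x => rfl) _).trans ?_
    exact congrArg (thetaEnvData C hC hS hl hp2 hpl hζ mods f hf hmods h15 L hZ hcharY hlim).envSet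
      (ThetaEnvData.image_iotaInvariants_of_conj (thetaEnvData C hC hS hl hp2 hpl hζ mods f hf hmods h15 L hZ hcharY hlim)
        (autActOfCor218i C hq μ hC hS h15 L R hR h218i α) ι.1
        (orbitEquivS C hC hS h15 L hq μ R hR h218i ι₀ α ι).1
        (orbitEquivS_apply_apply C hC hS h15 L hq μ R hR h218i ι₀ α ι) (hθ α))
  image_inftyThetaEnv ι := by
    change AddEquiv.toMultiplicative (autActOfCor218i C hq μ hC hS h15 L R hR h218i α) ''
        (thetaEnvData C hC hS hl hp2 hpl hζ mods f hf hmods h15 L hZ hcharY hlim).envSet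
          ((thetaEnvData C hC hS hl hp2 hpl hζ mods f hf hmods h15 L hZ hcharY hlim).thetaInftyIotaLim ι.1) =
      (thetaEnvData C hC hS hl hp2 hpl hζ mods f hf hmods h15 L hZ hcharY hlim).envSet
        ((thetaEnvData C hC hS hl hp2 hpl hζ mods f hf hmods h15 L hZ hcharY hlim).thetaInftyIotaLim
          (orbitEquivS C hC hS h15 L hq μ R hR h218i ι₀ α ι).1)
    refine (ThetaEnvData.image_envSet_of_compat (thetaEnvData C hC hS hl hp2 hpl hζ mods f hf hmods h15 L hZ hcharY hlim)
      (AddEquiv.toMultiplicative (autActOfCor218i C hq μ hC hS h15 L R hR h218i α))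
      (autActOfCor218i C hq μ hC hS h15 L R hR h218i α) (fun x => rfl) _).trans ?_
    exact congrArg (thetaEnvData C hC hS hl hp2 hpl hζ mods f hf hmods h15 L hZ hcharY hlim).envSet
      (ThetaEnvData.image_iotaInvariants_of_conj (thetaEnvData C hC hS hl hp2 hpl hζ mods f hf hmods h15 L hZ hcharY hlim)
        (autActOfCor218i C hq μ hC hS h15 L R hR h218i α) ι.1
        (orbitEquivS C hC hS h15 L hq μ R hR h218i ι₀ α ι).1
        (orbitEquivS_apply_apply C hC hS h15 L hq μ R hR h218i ι₀ α ι) (hinf α))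

/-- **J10 on the `I_sat(ι₀)`-indexed record — the FUNCTORIAL `Aut(Π^tp_{X̲̲_k})`-action by isomorphisms**
(`autActOfCor218i_refl/_trans` on the module, conjugation on the index set): p429735's `autIsoActionOrbitI` with the
new index set and WITHOUT binder (P2). [cite: Mochizuki2012, Prop 3.4 (i) p.91] -/
def autIsoActionOrbitS :
    TemperedThetaMonoids.ThetaEnvData.AutIsoAction
      (thetaEnvRecordSat C hC hS hl hp2 hpl hζ mods f hf hmods h15 L hZ hcharY hlim hq μ R hR h218i κ ι₀) where
  iso α := recordIsoOfS C hC hS hl hp2 hpl hζ mods f hf hmods h15 L hZ hcharY hlim hq μ R hR h218i κ ι₀ hκ hθ hinf α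
  iso_phi _ _ := rfl
  iso_refl_e x := congrArg Multiplicative.ofAdd
    (autActOfCor218i_refl C hq μ hC hS h15 L R hR h218i (Multiplicative.toAdd x))
  iso_refl_iota ι := Subtype.ext (AddEquiv.ext fun x => by
    change autActOfCor218i C hq μ hC hS h15 L R hR h218i (ContinuousMulEquiv.refl _)
        (ι.1 ((autActOfCor218i C hq μ hC hS h15 L R hR h218i (ContinuousMulEquiv.refl _)).symm x)) = ι.1 x
    rw [autActOfCor218i_refl]
    congr 1
    apply (autActOfCor218i C hq μ hC hS h15 L R hR h218i (ContinuousMulEquiv.refl _)).injective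
    rw [AddEquiv.apply_symm_apply, autActOfCor218i_refl])
  iso_trans_e α₁ α₂ x := congrArg Multiplicative.ofAdd
    (autActOfCor218i_trans C hq μ hC hS h15 L R hR h218i α₁ α₂ (Multiplicative.toAdd x))
  iso_trans_iota α₁ α₂ ι := Subtype.ext (AddEquiv.ext fun x => by
    change autActOfCor218i C hq μ hC hS h15 L R hR h218i (α₁.trans α₂)
        (ι.1 ((autActOfCor218i C hq μ hC hS h15 L R hR h218i (α₁.trans α₂)).symm x)) =
      autActOfCor218i C hq μ hC hS h15 L R hR h218i α₂ (autActOfCor218i C hq μ hC hS h15 L R hR h218i α₁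
        (ι.1 ((autActOfCor218i C hq μ hC hS h15 L R hR h218i α₁).symm
          ((autActOfCor218i C hq μ hC hS h15 L R hR h218i α₂).symm x))))
    erw [autActOfCor218i_trans]
    congr 3
    apply (autActOfCor218i C hq μ hC hS h15 L R hR h218i (α₁.trans α₂)).injective
    erw [AddEquiv.apply_symm_apply, autActOfCor218i_trans, AddEquiv.apply_symm_apply, AddEquiv.apply_symm_apply])

/-- **The transport input of Prop 3.4 (i) at the genuine data, `I_sat(ι₀)`-indexed form** (`ThetaEnvTransport.ofAutAction`
of the action above, over abc-iut-L6-d6's `ThetaSetting.ofDoubleUnderline`). [cite: Mochizuki2012, Prop 3.4 (i) p.91] -/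
def thetaEnvTransportS {η : (C.thetaEnvData μ hC hS).PiYdd → MuN p N}
    (hη : η ∈ (C.thetaEnvData μ hC hS).thetaCocycles) :
    TemperedThetaMonoids.ThetaEnvTransport (ThetaSetting.ofDoubleUnderline C μ hC hS hl hp2 hpl hζ hη) :=
  TemperedThetaMonoids.ThetaEnvTransport.ofAutAction
    (S := ThetaSetting.ofDoubleUnderline C μ hC hS hl hp2 hpl hζ hη)
    (thetaEnvRecordSat C hC hS hl hp2 hpl hζ mods f hf hmods h15 L hZ hcharY hlim hq μ R hR h218i κ ι₀)
    (autIsoActionOrbitS C hC hS hl hp2 hpl hζ mods f hf hmods h15 L hZ hcharY hlim hq μ R hR h218i κ ι₀ hκ hθ hinf)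

/-- **[IUTchII] Prop 3.4 (i) — MULTIRADIALITY OF SPLIT THETA MONOIDS AT THE GENUINE FUNCTOR, `ι` ranging over the
`Aut_top(Π^tp_{X̲̲})`-saturated orbit `I_sat(ι₀)` of the action of ONE inversion automorphism `ι₀`** — the functor
`Π_v ↦ (Π_v ↷ {Ψ^ι_env(𝕄_*(Π_v))}_{ι ∈ I_sat(ι₀)}, M^×_TM, Ψ_cns)` built from the NATURAL system of mono-theta environments
of `X̲̲_K`, transported along isomorphisms `Π_v ⥲ Π^tp_{X̲̲}` by the Π-INTRINSIC `Aut(Π^tp_{X̲̲})`-action, on the radial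
category of Example 1.8 (iii)/(iv) IS multiradially defined (abc-iut-w5-d169's `prop34i_multiradiallyDefined`, itself
abc-iut-L6-t1's `cor111_multiradiallyDefined`).  Binder (P1) := {[EtTh] Cor. 2.18 (i) (F-0620), `hq`} (p429735);
binder (P2) := NONE (this file); remaining binders: (P3) `hκ`, (P4) `hθ`/`hinf`. [cite: Mochizuki2012, Prop 3.4 (i) p.92] -/
theorem prop34i_multiradiallyDefined_saturated
    {η : (C.thetaEnvData μ hC hS).PiYdd → MuN p N} (hη : η ∈ (C.thetaEnvData μ hC hS).thetaCocycles)
    (Γ : Type) [Group Γ] :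
    ((ex18iii (ThetaSetting.ofDoubleUnderline C μ hC hS hl hp2 hpl hζ hη) Γ).toDagger
      (TemperedThetaMonoids.prop34iRadialFunctor
        (thetaEnvTransportS C hC hS hl hp2 hpl hζ mods f hf hmods h15 L hZ hcharY hlim hq μ R hR h218i κ ι₀ hκ hθ hinf hη)
        Γ)).IsMultiradiallyDefined :=
  TemperedThetaMonoids.prop34i_multiradiallyDefined _ Γ

end Action

end EtaleLevels
end Literature.IUT.HodgeArakelov
end
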